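import Summits.BirchSwinnertonDyer.Rank1Residual.GaloisImage.ContinuousH1CoefficientTransport
import Summits.BirchSwinnertonDyer.Rank1Residual.GaloisImage.KolyvaginDerivativeTate
import Literature.NumberTheory.EllipticCurves.GeomPointsGaloisModule
import Mathlib.Topology.Instances.ZMod
import HarnessLib

/-!
# `E[p^n]` with `ℤ_p`-coefficients as a target of the reduction `T_p E → E[p^n]`, and Kolyvagin's
# derivative classes of row T-DER read in the `ℤ`-linear currency `galoisCohomology (W.torsionGaloisModule m) 1`
# (cell `b2b-bsdres`, team n1011, row T-DER-GZ, file GZ-2; seat p13)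

HONEST FRAMING (cell `b2b-bsdres`, run/shared/lean/b2b/bsd-rank1-residual/, verbatim in every
file): the goal of the cell is to DELETE the COMBINATION-SHAPED residual classes of the
Birch–Swinnerton-Dyer formula for ALL analytic-rank `≤ 1` elliptic curves over `ℚ` — "full BSD
formula for every rank `≤ 1` curve in class `C`" assembled STRICTLY from published theorems — so
that the rank-`≤ 1` remainder becomes exactly the CONSTRUCTION-SHAPED classes, which are TYPED
(missing-input `Prop`s), NOT attempted. This is not "finishing BSD". Team n1011 (N10/N11, the
additive block `X4 ∧ p = 3`): research route on the CONSTRUCTION-SHAPED class X4 / §I N11 (route-1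
PORT); TOOL: three transparent DEFINITIONS (the `ℤ_p`-module structure on `p^n`-torsion, `E[p^n]` as a
`ℤ_p`-linear continuous Galois representation, the reduction map `T_p E ⟶ E[p^n]`) and theorems;
NO named fact, NO `sorry`; NO Euler system is asserted to exist (it is the hypothesis `hc`); nothing
is booked; no mark / label / flag text moves; census −0.

## What

* §1 `torsionBy.padicIntModule A p n : Module ℤ_[p] (A[p^n])` — `x • P := (x mod p^n) • P`, the
  recipe of `TateModule.instSMulPadicInt` one level at a time (a `def`, to be activated as a LOCAL
  instance like Mathlib's `AddSubgroup.torsionBy.zmodModule`); `continuous_toZModPow`;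
  `ContinuousSMul ℤ_[p] (A[p^n])` for discrete `A`; `natCast_smul_eq_nsmul`, `pow_smul_eq_zero`.
* §2 `torsionRepPadicInt W p n : GaloisRep F ℤ_[p] (geomTorsion W (p^n))` — the action `σ • P`
  (that of `W.torsionGaloisModule` / `W.torsionGaloisRep`) regarded `ℤ_p`-linearly.
* §3 `tateModuleRed W p h n : (W.tateGaloisRep p h).toTopRep ⟶ (torsionRepPadicInt W p n).toTopRep`
  — the `n`-th projection `TateModule.proj p n` (`ℤ_p`-linear by `TateModule.proj_smul`,
  continuous, equivariant): the coefficient map `red` of row T-DER for `T = T_p E`, `T' = E[p^n]`.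
* §4 the identity of `E[p^n]` (as `AddSubgroup.inclusion` along `geomTorsion W (p^n) = geomTorsion
  W m`, so that ANY spelling `m` of the level — e.g. DICT3₁'s `3^k·3` — is served without casts)
  is a continuous additive equivariant bijection between `(torsionRepPadicInt W p n).toTopRep`
  (`ℤ_p`-linear) and `(W.torsionGaloisModule m).toTopRep` (`ℤ`-linear), so GZ-1
  (`ContinuousH1CoefficientTransport`) applies; END **`Rat.exists_sigma_existsUnique_res_eq_deriv_torsionGaloisModule`**
  = n1011-p11's F5 `Derivative.Rat.exists_sigma_existsUnique_res_eq_deriv_tate` (THEOREM A3 for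
  `T_p E` over the cyclotomic levels of `ℚ`) with `T' = E[p^n]`, READ IN `ℤ`-CURRENCY: a UNIQUE
  `κ_r ∈ galoisCohomology (W.torsionGaloisModule m) 1` restricting on `Gal(ℚ̄/ℚ(μ_r))` to the
  transported derivative `D_r (Φ_U (red_* c_{0,r}))`.

References: J. H. Silverman, *AEC* (2009), III.§7 (`T_p E = lim E[p^n]`) [SilvermanAEC2009];
K. Rubin, *Euler Systems* (2000), Def. 4.4.4, Lemma 4.4.2, App. B.2 [Rubin2000]; B. Mazur,
K. Rubin, *Kolyvagin systems* (2004), App. A (32) [MazurRubin2004].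
-/

noncomputable section

open CategoryTheory Function Finset Field IsDedekindDomain
open scoped NumberField
open Literature.NumberTheory.GaloisRepresentations Literature.NumberTheory.EllipticCurves
open Summit.BirchSwinnertonDyer.Rank1Residual.GaloisImage.CoeffTransport

universe u

namespace Summit.BirchSwinnertonDyer.Rank1Residual.GaloisImage.TorsionCoeff

/-! ## §1 The `ℤ_p`-module structure on the `p^n`-torsion of an abelian group -/

section PadicIntModule

variable (p : ℕ) [Fact p.Prime] (n : ℕ)

/-- The reduction `ℤ_p → ℤ/p^n` is continuous for the discrete topology on `ℤ/p^n` (it is constant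
on the balls of radius `p^{-n}`: `PadicInt.ker_toZModPow`, `PadicInt.norm_le_pow_iff_mem_span_pow`).
[folklore] -/
theorem continuous_toZModPow : Continuous (PadicInt.toZModPow n : ℤ_[p] → ZMod (p ^ n)) := by
  refine continuous_def.2 fun s _ => Metric.isOpen_iff.2 fun x hx => ⟨(p : ℝ) ^ (-(n : ℤ)), ?_, ?_⟩
  · exact zpow_pos (by exact_mod_cast (Fact.out : p.Prime).pos) _
  · intro y hy
    rw [Metric.mem_ball, dist_eq_norm] at hy
    have hker : y - x ∈ RingHom.ker (PadicInt.toZModPow n : ℤ_[p] →+* ZMod (p ^ n)) := by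
      rw [PadicInt.ker_toZModPow, ← PadicInt.norm_le_pow_iff_mem_span_pow]
      exact hy.le
    rw [RingHom.mem_ker, map_sub, sub_eq_zero] at hker
    rw [Set.mem_preimage, hker]
    exact hx

variable (A : Type u) [AddCommGroup A]

/-- **(D1) The `ℤ_p`-module structure on the `p^n`-torsion `A[p^n]` of an abelian group**:
`x • P := (x mod p^n) • P` — well defined because `p^n • P = 0` (`AddSubgroup.torsionBy.nsmul`);
this is the recipe of the tree's `TateModule.instSMulPadicInt` at one level.  A `def` (reducible),
to be activated as a LOCAL instance (`attribute [local instance]`), exactly like Mathlib's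
`AddSubgroup.torsionBy.zmodModule`.  Silverman, *AEC*, III.§7. [folklore] -/
@[reducible] def torsionBy.padicIntModule :
    Module ℤ_[p] (AddSubgroup.torsionBy A ((p ^ n : ℕ) : ℤ)) where
  smul x P := (PadicInt.toZModPow n x).val • P
  one_smul P := by
    change (PadicInt.toZModPow n (1 : ℤ_[p])).val • P = P
    rw [map_one, ZMod.val_one_eq_one_mod, ← AddSubgroup.torsionBy.mod_self_nsmul, one_smul]
  mul_smul x y P := by
    haveI : NeZero (p ^ n) := ⟨pow_ne_zero n (Fact.out : p.Prime).ne_zero⟩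
    change (PadicInt.toZModPow n (x * y)).val • P =
      (PadicInt.toZModPow n x).val • (PadicInt.toZModPow n y).val • P
    rw [map_mul, ZMod.val_mul, ← AddSubgroup.torsionBy.mod_self_nsmul, mul_smul]
  smul_zero x := nsmul_zero _
  smul_add x P Q := nsmul_add _ _ _
  add_smul x y P := by
    haveI : NeZero (p ^ n) := ⟨pow_ne_zero n (Fact.out : p.Prime).ne_zero⟩
    change (PadicInt.toZModPow n (x + y)).val • P =
      (PadicInt.toZModPow n x).val • P + (PadicInt.toZModPow n y).val • P
    rw [map_add, ZMod.val_add, ← AddSubgroup.torsionBy.mod_self_nsmul, add_smul]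
  zero_smul P := by
    change (PadicInt.toZModPow n (0 : ℤ_[p])).val • P = 0
    rw [map_zero, ZMod.val_zero, zero_smul]

attribute [local instance] torsionBy.padicIntModule

/-- Unfolding (D1): `x • P = (x mod p^n).val • P`. [folklore] -/
theorem smul_def (x : ℤ_[p]) (P : AddSubgroup.torsionBy A ((p ^ n : ℕ) : ℤ)) :
    x • P = (PadicInt.toZModPow n x).val • P :=
  rfl

/-- A natural number acts through (D1) as itself: `(k : ℤ_p) • P = k • P`. [folklore] -/
theorem natCast_smul_eq_nsmul (k : ℕ) (P : AddSubgroup.torsionBy A ((p ^ n : ℕ) : ℤ)) :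
    (k : ℤ_[p]) • P = k • P := by
  rw [smul_def, map_natCast, ZMod.val_natCast, ← AddSubgroup.torsionBy.mod_self_nsmul]

/-- `p^n` kills `A[p^n]` through (D1): the hypothesis `hM` of row T-DER's THEOREM A at `k = n`.
[folklore] -/
theorem pow_smul_eq_zero (P : AddSubgroup.torsionBy A ((p ^ n : ℕ) : ℤ)) :
    ((p : ℤ_[p]) ^ n) • P = 0 := by
  rw [← Nat.cast_pow, natCast_smul_eq_nsmul]
  exact AddSubgroup.torsionBy.nsmul P

/-- The (D1)-action is jointly continuous for the discrete topology on `A[p^n]` (it factors through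
the discrete `ℤ/p^n × A[p^n]`). [folklore] -/
instance continuousSMul [TopologicalSpace A] [DiscreteTopology A] :
    ContinuousSMul ℤ_[p] (AddSubgroup.torsionBy A ((p ^ n : ℕ) : ℤ)) :=
  ⟨(continuous_of_discreteTopology (f := fun q : ZMod (p ^ n) ×
      AddSubgroup.torsionBy A ((p ^ n : ℕ) : ℤ) => q.1.val • q.2)).comp
    ((continuous_toZModPow p n).prodMap continuous_id)⟩

end PadicIntModule

attribute [local instance] torsionBy.padicIntModule

/-! ## §2 `E[p^n]` as a `ℤ_p`-linear continuous Galois representation -/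

section Rep

variable {F : Type} [Field F] (W : WeierstrassCurve F) (p : ℕ) [Fact p.Prime] (n : ℕ)

/-- **(D2) `E[p^n]` as a continuous Galois representation with `ℤ_p`-coefficients**
`GaloisRep F ℤ_[p] (geomTorsion W (p^n))`: the action `σ • P` of `Γ_F` on the geometric
`p^n`-torsion (that of `W.torsionGaloisModule` / `W.torsionGaloisRep`), which is `ℤ_p`-linear for
(D1) and jointly continuous (discrete `E(F̄)`, `continuousSMul_geomPoints'`).
Silverman, *AEC*, III.§7; Rubin, *Euler Systems* (2000), §1.1. [folklore] -/
def torsionRepPadicInt : GaloisRep F ℤ_[p] (WeierstrassCurve.geomTorsion W ((p ^ n : ℕ) : ℤ)) :=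
  ⟨{ toFun := fun σ =>
      { toFun := fun P => σ • P
        map_add' := smul_add σ
        map_smul' := fun x P => by
          change σ • ((PadicInt.toZModPow n x).val • P) = (PadicInt.toZModPow n x).val • σ • P
          exact smul_comm σ (PadicInt.toZModPow n x).val P }
     map_one' := LinearMap.ext fun P => one_smul _ P
     map_mul' := fun σ τ => LinearMap.ext fun P => mul_smul σ τ P },
   by
    haveI := W.continuousSMul_geomPoints'
    refine continuous_induced_rng.2 ?_
    exact continuous_fst.smul (continuous_subtype_val.comp continuous_snd)⟩

/-- Unfolding (D2): `ρ σ P = σ • P`. [folklore] -/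
@[simp]
theorem torsionRepPadicInt_apply (σ : absoluteGaloisGroup F)
    (P : WeierstrassCurve.geomTorsion W ((p ^ n : ℕ) : ℤ)) : torsionRepPadicInt W p n σ P = σ • P :=
  rfl

/-- The `TopRep` action of (D2) is `σ • P`. [folklore] -/
theorem toTopRep_torsionRepPadicInt_ρ_apply (σ : absoluteGaloisGroup F)
    (P : WeierstrassCurve.geomTorsion W ((p ^ n : ℕ) : ℤ)) :
    (torsionRepPadicInt W p n).toTopRep.ρ σ P = σ • P :=
  rfl

end Rep

/-! ## §3 The reduction `T_p E ⟶ E[p^n]` as a morphism of `ℤ_p`-linear topological representations -/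

section Red

variable {F : Type} [Field F] (W : WeierstrassCurve F) (p : ℕ) [Fact p.Prime]

/-- **(D3) The reduction map `red_n : T_p E ⟶ E[p^n]`**, `a = (a_k)_k ↦ a_n`, as a morphism in
`TopRep ℤ_[p] Γ_F` from `(W.tateGaloisRep p h).toTopRep` to `(torsionRepPadicInt W p n).toTopRep`:
`ℤ_p`-linear by `TateModule.proj_smul`, continuous by `TateModule.continuous_proj`, equivariant by
`TateModule.proj_smul_of_distribMulAction`.  This is the coefficient map `red` of row T-DER
(`Derivative.Rat.exists_sigma_existsUnique_res_eq_deriv_tate`) for `T' = E[p^n]`.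
Silverman, *AEC*, III.§7 (`T_p E = lim E[p^n]`). [folklore] -/
def tateModuleRed [ContinuousSMul ℤ_[p] (W.tateModule p)]
    (h : Continuous fun x : absoluteGaloisGroup F × W.tateModule p => W.galoisRepTate p x.1 x.2)
    (n : ℕ) : (W.tateGaloisRep p h).toTopRep ⟶ (torsionRepPadicInt W p n).toTopRep :=
  TopRep.ofHom
    ⟨⟨{ toFun := fun a => ⟨TateModule.proj p n a, W.proj_tateModule_mem_geomTorsion p n a⟩
        map_add' := fun a b => Subtype.ext (map_add _ a b)
        map_smul' := fun x a => Subtype.ext (TateModule.proj_smul x a n) },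
      (TateModule.continuous_proj n).subtype_mk _⟩,
     fun σ => by ext a; rfl⟩

/-- Unfolding (D3): `red_n a = a_n`. [folklore] -/
@[simp]
theorem coe_tateModuleRed_apply [ContinuousSMul ℤ_[p] (W.tateModule p)]
    (h : Continuous fun x : absoluteGaloisGroup F × W.tateModule p => W.galoisRepTate p x.1 x.2)
    (n : ℕ) (a : W.tateModule p) :
    (((tateModuleRed W p h n).hom a : WeierstrassCurve.geomTorsion W ((p ^ n : ℕ) : ℤ)) :
      WeierstrassCurve.geomPoints W) = TateModule.proj p n a :=
  rfl

end Red

/-! ## §4 The identity `E[p^n]_{ℤ_p} → E[m]_ℤ` is a homeomorphic additive equivariant bijection;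
Kolyvagin's derivative classes for `T_p E` read in `galoisCohomology (W.torsionGaloisModule m) 1` -/

section Reading

variable {F : Type} [Field F] (W : WeierstrassCurve F) (p : ℕ) [Fact p.Prime] (n : ℕ)

/-- The inclusion along an equality of torsion levels `geomTorsion W (p^n) = geomTorsion W m`
intertwines the `ℤ_p`-linear action (D2) and the `ℤ`-linear action of `W.torsionGaloisModule m`
(both are `σ • P`). [folklore] -/
theorem inclusion_equivariant {m : ℤ}
    (hm : WeierstrassCurve.geomTorsion W ((p ^ n : ℕ) : ℤ) = WeierstrassCurve.geomTorsion W m)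
    (σ : absoluteGaloisGroup F) (P : (torsionRepPadicInt W p n).toTopRep) :
    AddSubgroup.inclusion hm.le ((torsionRepPadicInt W p n).toTopRep.ρ σ P) =
      (W.torsionGaloisModule m).toTopRep.ρ σ (AddSubgroup.inclusion hm.le P) :=
  rfl

variable (W : WeierstrassCurve ℚ) [W.IsElliptic] [W.IsGloballyMinimal]

/-- **Kolyvagin's derivative classes for `T_p E` over the cyclotomic levels of `ℚ`, READ IN THE
`ℤ`-LINEAR CURRENCY `galoisCohomology (W.torsionGaloisModule m) 1`** (`m` any spelling of the level
with `geomTorsion W (p^n) = geomTorsion W m`).  For an Euler system `c` of `T_p E` over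
`cyclotomicLevelsRat p S`, a level `r` of Kolyvagin primes of level `n ≥ 1` and
`E[m]^{Gal(ℚ̄/ℚ(μ_r))} = 0` (`h0`; under `Irr(E[p])` the tree's
`geomTorsion_eq_zero_of_commutator_fixed_of_irreducible`): there are generators `σ_ℓ` (T-DER-INST),
an additive transport `Φ_U : H¹(U_r, E[p^n]_{ℤ_p}) →+ H¹(U_r, E[m]_ℤ)` computed on cocycles by the
identity (GZ-1), and a UNIQUE `κ_r ∈ galoisCohomology (W.torsionGaloisModule m) 1` with
`res_{U_r} κ_r = D_r (Φ_U (red_{n,*} c_{0,r}))`, `D_r = ∏_{ℓ∈r} Σ_{j<ℓ-1} j σ_ℓ^j` acting `ℤ`-linearly —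
n1011-p11's F5 `Derivative.Rat.exists_sigma_existsUnique_res_eq_deriv_tate` with `T' = E[p^n]`
(`torsionRepPadicInt`, `red = tateModuleRed`, `hM` = `pow_smul_eq_zero`) transported by
`CoeffTransport.exists_addEquiv_oneCocycleClass` / `comm_resSubgroup` / `comm_noncommProd_deriv_conjMap`.
The instance arguments on `T_p E` are the tree's `W.module_free_tateModule_holds p`,
`W.module_finite_tateModule_holds p`, `TateModule.continuousSMul_padicInt` (supply with `haveI`).
[cite: Rubin2000, Def. 4.4.4 and Lemma 4.4.2] -/
theorem Rat.exists_sigma_existsUnique_res_eq_deriv_torsionGaloisModule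
    [Module.Free ℤ_[p] (W.tateModule p)] [Module.Finite ℤ_[p] (W.tateModule p)]
    [ContinuousSMul ℤ_[p] (W.tateModule p)]
    (S : Set (HeightOneSpectrum (𝓞 ℚ))) (hn : 0 < n)
    {c : ∀ (i : ℕ) (r : (cyclotomicLevelsRat p S).Ideals),
      H1 (W.tateGaloisRep p (W.continuous_galoisRepTate_holds p)) ((cyclotomicLevelsRat p S).level i r.1)}
    (hc : IsEulerSystem (cyclotomicLevelsRat p S)
      (W.tateGaloisRep p (W.continuous_galoisRepTate_holds p)) p c)
    (r : (cyclotomicLevelsRat p S).Ideals)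
    (hr : ∀ ℓ ∈ r.1, Kato.IsKolyvaginPrime W p n ((Rat.HeightOneSpectrum.primesEquiv ℓ : Nat.Primes) : ℕ))
    {m : ℤ} (hm : WeierstrassCurve.geomTorsion W ((p ^ n : ℕ) : ℤ) = WeierstrassCurve.geomTorsion W m)
    (h0 : ∀ P : WeierstrassCurve.geomTorsion W m,
      (∀ u : (cyclotomicLevelsRat p S).level ⊥ r.1, (u : absoluteGaloisGroup ℚ) • P = P) → P = 0) :
    ∃ σ : HeightOneSpectrum (𝓞 ℚ) → absoluteGaloisGroup ℚ,
      (∀ ℓ ∈ r.1, ∀ k : ℕ, (((Rat.HeightOneSpectrum.primesEquiv ℓ : Nat.Primes) : ℕ)).Coprime k →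
        σ ℓ ∈ rootsOfUnityFixer ℚ k) ∧
      (∀ ℓ ∈ r.1, ∀ g : absoluteGaloisGroup ℚ,
        ∃ j < ((Rat.HeightOneSpectrum.primesEquiv ℓ : Nat.Primes) : ℕ) - 1,
          (σ ℓ ^ j)⁻¹ * g ∈ (cyclotomicLevelsRat p S).tameLevel ℓ) ∧
      ∃ (Φ : continuousCohomology 1 (subgroupRep (torsionRepPadicInt W p n).toTopRep
              ((cyclotomicLevelsRat p S).level ⊥ r.1)) →+
            continuousCohomology 1 (subgroupRep (W.torsionGaloisModule m).toTopRep
              ((cyclotomicLevelsRat p S).level ⊥ r.1))),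
        (∀ (φ : contOneCocycles (subgroupRep (torsionRepPadicInt W p n).toTopRep
              ((cyclotomicLevelsRat p S).level ⊥ r.1)))
           (ψ : contOneCocycles (subgroupRep (W.torsionGaloisModule m).toTopRep
              ((cyclotomicLevelsRat p S).level ⊥ r.1))),
          (∀ g, ψ.1 g = AddSubgroup.inclusion hm.le (φ.1 g)) →
            Φ (oneCocycleClass _ φ) = oneCocycleClass _ ψ) ∧
      ∃ comm, ∃! κ : galoisCohomology (W.torsionGaloisModule m) 1,
        resSubgroup (W.torsionGaloisModule m).toTopRep ((cyclotomicLevelsRat p S).level ⊥ r.1) 1 κ =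
          (r.1.noncommProd (fun ℓ => ∑ j ∈ range (((Rat.HeightOneSpectrum.primesEquiv ℓ : Nat.Primes)
              : ℕ) - 1), (j : Module.End ℤ (continuousCohomology 1
              (subgroupRep (W.torsionGaloisModule m).toTopRep ((cyclotomicLevelsRat p S).level ⊥ r.1)))) *
            (conjMap (W.torsionGaloisModule m).toTopRep ((cyclotomicLevelsRat p S).level ⊥ r.1)
              (σ ℓ) 1).hom.toLinearMap ^ j) comm)
          (Φ (ContinuousCohomology.map (ContinuousMonoidHom.id _)
            (X := subgroupRep (W.tateGaloisRep p (W.continuous_galoisRepTate_holds p)).toTopRep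
              ((cyclotomicLevelsRat p S).level ⊥ r.1))
            (Y := subgroupRep (torsionRepPadicInt W p n).toTopRep ((cyclotomicLevelsRat p S).level ⊥ r.1))
            ((TopRep.resFunctor ((cyclotomicLevelsRat p S).level ⊥ r.1).subtype).map
              (tateModuleRed W p (W.continuous_galoisRepTate_holds p) n)) 1
            (c ⊥ r))) := by
  -- abbreviations
  set U := (cyclotomicLevelsRat p S).level ⊥ r.1 with hU
  set X := (torsionRepPadicInt W p n).toTopRep with hX
  set Y := (W.torsionGaloisModule m).toTopRep with hY
  -- the transport data: the inclusion along `hm` and its inverse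
  set e : X →+ Y := (AddSubgroup.inclusion hm.le : _ →+ _) with he_def
  set einv : Y →+ X := (AddSubgroup.inclusion hm.ge : _ →+ _) with heinv_def
  have hec : Continuous e := continuous_of_discreteTopology
  have hic : Continuous einv := continuous_of_discreteTopology
  have he : ∀ (g : absoluteGaloisGroup ℚ) (x : X), e (X.ρ g x) = Y.ρ g (e x) := fun _ _ => rfl
  have h₁ : ∀ x, einv (e x) = x := fun x => Subtype.ext rfl
  have h₂ : ∀ y, e (einv y) = y := fun y => Subtype.ext rfl
  -- `h0` in `E[p^n]_{ℤ_p}`-currency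
  have h0' : ∀ v : X, (∀ u : U, X.ρ (u : absoluteGaloisGroup ℚ) v = v) → v = 0 := by
    intro v hv
    have h := h0 (e v) fun u => by
      have := congrArg e (hv u)
      exact this
    have := congrArg einv h
    rwa [h₁, map_zero] at this
  -- F5 for `T' = E[p^n]`
  obtain ⟨σ, hcop, hcov, comm, κ', hκ', huniq⟩ :=
    Derivative.Rat.exists_sigma_existsUnique_res_eq_deriv_tate W p S hn hc
      (tateModuleRed W p (W.continuous_galoisRepTate_holds p) n)
      (fun P => pow_smul_eq_zero p n _ P) r hr h0'
  -- the transports (GZ-1): on `Γ_ℚ` (an additive isomorphism) and on `U_r`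
  obtain ⟨Φ₀, hΦ₀⟩ := exists_addEquiv_oneCocycleClass X Y e hec he einv hic h₁ h₂
  obtain ⟨Φ, hΦ⟩ := exists_addMonoidHom_oneCocycleClass (subgroupRep X U) (subgroupRep Y U) e hec
    (fun g x => he g x)
  have hΦinj : Function.Injective Φ :=
    injective_of_oneCocycleClass (subgroupRep X U) (subgroupRep Y U) e (fun g x => he g x) einv h₁ h₂
      Φ hΦ hec
  refine ⟨σ, hcop, hcov, Φ, hΦ, Derivative.pairwise_commute_deriv (L := cyclotomicLevelsRat p S)
    (T' := W.torsionGaloisModule m) ⊥ r.1 σ _, Φ₀ κ', ?_, fun κ₁ hκ₁ => ?_⟩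
  · -- the restriction of the transported class is the transported derivative
    change resSubgroup Y U 1 (Φ₀.toAddMonoidHom κ') = _
    rw [← comm_resSubgroup X Y e U Φ₀.toAddMonoidHom (fun φ ψ h => hΦ₀ φ ψ h) Φ hΦ hec he κ',
      hκ', comm_noncommProd_deriv_conjMap X Y e U σ _ r.1 Φ hΦ hec he]
  · -- uniqueness: pull back along the additive isomorphism and use `ℤ_p`-side uniqueness
    have hpre : resSubgroup X U 1 (Φ₀.symm κ₁) = resSubgroup X U 1 κ' := by
      apply hΦinj
      rw [hκ', comm_noncommProd_deriv_conjMap X Y e U σ _ r.1 Φ hΦ hec he,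
        comm_resSubgroup X Y e U Φ₀.toAddMonoidHom (fun φ ψ h => hΦ₀ φ ψ h) Φ hΦ hec he
          (Φ₀.symm κ₁)]
      change resSubgroup Y U 1 (Φ₀ (Φ₀.symm κ₁)) = _
      rw [AddEquiv.apply_symm_apply]
      exact hκ₁
    have := huniq (Φ₀.symm κ₁) (hpre.trans hκ')
    rw [← this, AddEquiv.apply_symm_apply]

end Reading

end Summit.BirchSwinnertonDyer.Rank1Residual.GaloisImage.TorsionCoeff

end
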